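/-
Copyright (c) 2026 the pub-hodgecm-mathlib formalisation cell (harness21).  Prover seat hodgecm-mathlib-F0P3-p01 (g32), Track A «(D-RAM) FOUR-FRAME», unit U2H, census leaf
(ρ2b′-X) — T5b «toric level census, type RamK», organ (M-RK1): the units of the order `𝒪_E + ϖ^c𝒪_M` that are fixed by a second, commuting involution.  2026-09-04.
-/
import Literature.NumberTheory.LocalFields.QuadraticOrderIntegralBasis    -- ★ p857021: orders `𝒪^ρ + c𝒪`, `mem_order_iff_exists`, `fixed_coords_unique`, ring closure
import Literature.NumberTheory.LocalFields.WildQuadraticEisensteinFrame    -- ★ `exists_fixed_coords_of_map_ne`, `v_fixed_add_fixed_mul_eq_max` (Eisenstein coordinates, base parity)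
import HarnessLib

/-!
# Units of a quadratic order fixed by a commuting involution: `(𝒪_E + ϖ^c𝒪_M)ˣ ∩ K♮ = 𝒪_Fˣ · (1 + ϖ^{2⌈c∕2⌉}𝒪_{K♮})`
(Serre, *Local Fields* Ch. III §6 Prop. 12 (coordinates on an integral power basis), Ch. IV §1 (the function `i(s) = v(s x − x)`), Ch. V §1 (the filtration `U^{(n)}`))

Topic `NumberTheory/LocalFields`; namespace `Literature.NumberTheory.LocalFields.QuadraticOrder` (joins ★ parts I–III `QuadraticOrderIntegralBasis` ∕ `QuadraticOrderLattices` ∕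
`QuadraticOrderHermitianDual`, p857021 ∕ p857040 ∕ p857067).  THEOREMS ONLY (no definition, no instance, no notation, no named fact, no `sorry`); kernel lane
`--supports stmt-HodgeConjecture-24833` (count-neutral).  Cell `pub/hodgecm-mathlib` (D-0151), crux H413, Track A, unit U2H, census leaf (ρ2b′-X) `stub_U2H_fixedPointCensus_typeTwo_unit0`:
organ (M-RK1) of the T5b statement sheet `F0/P3/F0P3-p01/g32/T5bToricLevelCensusRamK.statements.v2` (hodgecm-mathlib-F0P3-p01 (g32); payer of record LH4-p14 (g3), plan owner
LH4-p12 (g4) T5-FRAME v1).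

SETTING (one field `K` = model of the biquadratic field `M`): `ρ` = the involution fixing `E`, `Θ` = a second ring endomorphism COMMUTING with `ρ` (`Θρ = ρΘ`; in the census: the
adjoint involution fixing the third field `K♮`), `ϖ` a `ρ`-FIXED uniformiser of `K` (`|ϖ| = exp(−1)`) which is NOT `Θ`-fixed, and BASE PARITY for `Θ` (`Θ`-fixed non-zero elements
have even valuation — `(M, Θ, ϖ)` is a ramified quadratic datum, ★ `IsRamifiedQuadraticDatum`).  The order of conductor `ϖ^c` for `ρ` is the ★ spelled-out predicate
`|z| ≤ 1 ∧ |z − ρz| ≤ |ϖ^c(α − ρα)|` (`α` with `ρα ≠ α`, `|α| ≤ 1`, `hint`).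

* §1 `exists_fixed_mul_near_one_iff_mem_order` — a UNIT `u` lies in the order of conductor `ϖ^c` iff `u = e·m` with `e` a `ρ`-fixed unit and `|m − 1| ≤ |ϖ|^c`
  (`(𝒪_E + ϖ^c𝒪_M)ˣ = 𝒪_Eˣ·U_M^{(c)}`; ★ `mem_order_iff_exists`).
* §2 `map_fixed_coords_of_commute` — the `Θ`-FIXED COORDINATES of a `ρ`-fixed element are `ρ`-fixed (`Θρ = ρΘ`, ★ `fixed_coords_unique`); `v_map_sub_self_le_of_v_sub_one_le` — the
  LEVEL SHIFT `|Θm − m| ≤ |ϖ|^{c−1}·|ϖ − Θϖ|` for `|m − 1| ≤ |ϖ|^c` (Serre IV §1 on the Eisenstein coordinates).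
* §3 **`exists_fixed_fixed_mul_iff_exists_fixed_mul`** — THE THEOREM: for a `Θ`-fixed unit `u`,
  `(∃ e m, ρe = e ∧ |e| = 1 ∧ |m − 1| ≤ |ϖ|^c ∧ u = e·m) ↔ (∃ f w, ρf = f ∧ Θf = f ∧ |f| = 1 ∧ Θw = w ∧ |w − 1| ≤ |ϖ|^c ∧ u = f·w)`, and the parity upgrade
  `|w − 1| ≤ |ϖ|^{2⌈c∕2⌉}` (`v_sub_one_le_of_theta_fixed`): the `Θ`-trick `e∕Θe = Θm∕m` forces the `ϖ`-coordinate of `e` into `𝔭^{c−1}` — `d`-FREE (only `Θϖ ≠ ϖ` is used).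
  In the census (type RamK, `K♮∕F` unramified): `𝒪_{K♮}ˣ ∩ 𝒪_cˣ = 𝒪_Fˣ·U_{K♮}^{(⌈c∕2⌉)}`, whence `[𝒪_{K♮}ˣ𝒪_cˣ : 𝒪_cˣ] = (q+1)q^{⌈c∕2⌉−1}` (memo §2; the count is a separate file).
HONEST LABEL: HC_CM is proved only modulo the 7 printed citations (2 remaining named inputs: hLiu418 = stmt-HodgeConjecture-24832, h413 = stmt-HodgeConjecture-24833) until rung 0
closes; unconditional local algebra, count-neutral (organ (M-RK1) of T5b; (ρ2b′-X) stays an OPEN prover target).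

## References
* [Serre1979] J.-P. Serre, *Local Fields*, GTM 67 (1979): Ch. III §6 Prop. 12 (integral power basis and its coordinates), Ch. IV §1 (`i_G(s) = v(s(x) − x) − 1` on a generator),
  Ch. V §1 (the filtration `U^{(n)}` of the units).
-/

set_option autoImplicit false

open WithZero

namespace Literature.NumberTheory.LocalFields.QuadraticOrder

variable {K : Type*} [Field K] [Valued K ℤᵐ⁰] {ρ Θ : K →+* K} {α : K}

/-! ## §1 The units of the order of conductor `ϖ^c` are `𝒪_Eˣ · U^{(c)}` -/

/-- **`(𝒪_E + ϖ^c𝒪_M)ˣ = 𝒪_Eˣ·U^{(c)}`**: a UNIT `u` lies in the order of conductor `ϖ^c` iff `u = e·m` with `e` a `ρ`-fixed unit and `|m − 1| ≤ |ϖ|^c`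
(`→`: ★ `mem_order_iff_exists` gives `u = a + ϖ^c y`, and `a` is a unit; `←`: the order is a ring containing the fixed integers and `ϖ^c𝒪`). [cite: Serre1979, Ch. III §6 Prop. 12] -/
theorem exists_fixed_mul_near_one_iff_mem_order (hρρ : ∀ x, ρ (ρ x) = x) (hvρ : ∀ x, Valued.v (ρ x) = Valued.v x) (hα : ρ α ≠ α) (hα1 : Valued.v α ≤ 1)
    (hint : ∀ z : K, Valued.v z ≤ 1 → Valued.v ((z - ρ z) / (α - ρ α)) ≤ 1)
    {ϖ : K} (hρϖ : ρ ϖ = ϖ) (hϖ : Valued.v ϖ = exp (-1 : ℤ)) (c : ℕ) {u : K} (hu1 : Valued.v u = 1) :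
    (Valued.v u ≤ 1 ∧ Valued.v (u - ρ u) ≤ Valued.v (ϖ ^ c * (α - ρ α))) ↔
      ∃ e m : K, ρ e = e ∧ Valued.v e = 1 ∧ Valued.v (m - 1) ≤ exp (-(c : ℤ)) ∧ u = e * m := by
  have hϖ0 : ϖ ≠ 0 := (Valuation.ne_zero_iff _).1 (by rw [hϖ]; exact exp_ne_zero)
  have hϖc : Valued.v (ϖ ^ c) = exp (-(c : ℤ)) := by rw [map_pow, hϖ, ← exp_nsmul]; simp
  have hρϖc : ρ (ϖ ^ c) = ϖ ^ c := by rw [map_pow, hρϖ]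
  have hϖc1 : Valued.v (ϖ ^ c) ≤ 1 := by rw [hϖc, ← exp_zero, exp_le_exp]; omega
  constructor
  · intro h
    obtain ⟨a, y, ha, ha1, hy, hu⟩ := (mem_order_iff_exists hρρ hα hα1 hint hρϖc (pow_ne_zero _ hϖ0) hϖc1 u).1 h
    rcases Nat.eq_zero_or_pos c with rfl | hc
    · exact ⟨1, u, map_one ρ, map_one _, by
        rw [Nat.cast_zero, neg_zero, exp_zero]; exact (Valuation.map_sub _ _ _).trans (max_le h.1 (by rw [map_one])), (one_mul u).symm⟩
    · have hcy : Valued.v (ϖ ^ c * y) < 1 := by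
        rw [map_mul, hϖc]
        calc exp (-(c : ℤ)) * Valued.v y ≤ exp (-(c : ℤ)) * 1 := mul_le_mul' le_rfl hy
          _ < 1 := by rw [mul_one, ← exp_zero, exp_lt_exp]; omega
      have ha' : Valued.v a = 1 := by
        have h1 : a = u - ϖ ^ c * y := by rw [hu]; ring
        rw [h1, Valuation.map_sub_eq_of_lt_left _ (by rw [hu1]; exact hcy), hu1]
      have ha0 : a ≠ 0 := (Valuation.ne_zero_iff _).1 (by rw [ha']; exact one_ne_zero)
      refine ⟨a, 1 + ϖ ^ c * y / a, ha, ha', ?_, ?_⟩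
      · rw [add_sub_cancel_left, map_div₀, ha', div_one, map_mul, hϖc]
        calc exp (-(c : ℤ)) * Valued.v y ≤ exp (-(c : ℤ)) * 1 := mul_le_mul' le_rfl hy
          _ = exp (-(c : ℤ)) := mul_one _
      · rw [hu]; field_simp
  · rintro ⟨e, m, he, he1, hm, rfl⟩
    have hm' : m = 1 + ϖ ^ c * ((m - 1) / ϖ ^ c) := by field_simp; ring
    have hy : Valued.v ((m - 1) / ϖ ^ c) ≤ 1 := by
      rw [map_div₀, hϖc]; exact div_le_one_of_le₀ hm zero_le
    rw [hm']
    exact mul_mem_order hvρ (mem_order_of_fixed _ he he1.le) (add_mem_order (one_mem_order _) (conductor_mul_mem_order hα hint hρϖc hϖc1 hy))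

/-! ## §2 Two commuting involutions: `Θ`-fixed coordinates of `ρ`-fixed elements; the level shift of `Θ` on `U^{(c)}` -/

omit [Valued K ℤᵐ⁰] in
/-- **COMMUTING INVOLUTIONS**: if `Θρ = ρΘ`, `ρϖ = ϖ`, `Θϖ ≠ ϖ`, and `z = a + b·ϖ` with `Θa = a`, `Θb = b`, then `ρz = z` forces `ρa = a` and `ρb = b` (`ρa`, `ρb` are again
`Θ`-fixed coordinates of `z`; ★ `fixed_coords_unique`). [cite: Serre1979, Ch. III §6 Prop. 12] -/
theorem map_fixed_coords_of_commute (hΘρ : ∀ x, Θ (ρ x) = ρ (Θ x)) {ϖ : K} (hρϖ : ρ ϖ = ϖ) (hΘϖ : Θ ϖ ≠ ϖ)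
    {a b z : K} (ha : Θ a = a) (hb : Θ b = b) (hz : z = a + b * ϖ) (hρz : ρ z = z) : ρ a = a ∧ ρ b = b := by
  have hρa : Θ (ρ a) = ρ a := by rw [hΘρ, ha]
  have hρb : Θ (ρ b) = ρ b := by rw [hΘρ, hb]
  have h : ρ a + ρ b * ϖ = a + b * ϖ := by
    have := congrArg ρ hz
    rw [hρz, map_add, map_mul, hρϖ] at this
    rw [← this]; exact hz
  exact fixed_coords_unique hΘϖ hρa hρb ha hb h

/-- **THE LEVEL SHIFT OF `Θ` ON `U^{(c)}`** (Serre IV §1 in coordinates): under base parity for `Θ` and `|ϖ| = exp(−1)`, `|m − 1| ≤ |ϖ|^c` (`c ≥ 1`) gives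
`|Θm − m| ≤ |ϖ|^{c−1}·|ϖ − Θϖ|` (`m − 1 = a′ + b′ϖ`, `Θm − m = b′(Θϖ − ϖ)`, `|b′|·|ϖ| ≤ |m − 1|`). [cite: Serre1979, Ch. IV §1] -/
theorem v_map_sub_self_le_of_v_sub_one_le (hΘΘ : ∀ x, Θ (Θ x) = x) (hfix : ∀ c : K, Θ c = c → c ≠ 0 → Even (log (Valued.v c)))
    {ϖ : K} (hϖ : Valued.v ϖ = exp (-1 : ℤ)) (hΘϖ : Θ ϖ ≠ ϖ) {c : ℕ} {m : K} (hm : Valued.v (m - 1) ≤ exp (-(c : ℤ))) :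
    Valued.v (Θ m - m) ≤ exp (-((c : ℤ) - 1)) * Valued.v (ϖ - Θ ϖ) := by
  obtain ⟨a', b', ha', hb', hx⟩ := exists_fixed_coords_of_map_ne hΘΘ hΘϖ (m - 1)
  have hΘx : Θ m - m = b' * (Θ ϖ - ϖ) := by
    have h1 : Θ m - m = Θ (m - 1) - (m - 1) := by rw [map_sub, map_one]; ring
    have h2 : Θ (m - 1) = a' + b' * Θ ϖ := by rw [hx, map_add, map_mul, ha', hb']
    rw [h1, h2, hx]; ring
  have hb'le : Valued.v b' * exp (-1 : ℤ) ≤ exp (-(c : ℤ)) := by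
    have := hm; rw [hx, v_fixed_add_fixed_mul_eq_max hfix hϖ ha' hb'] at this
    exact (le_max_right _ _).trans this
  have hb'le' : Valued.v b' ≤ exp (-((c : ℤ) - 1)) := by
    rcases eq_or_ne b' 0 with rfl | hb0
    · rw [map_zero]; exact zero_le
    have hvb0 : Valued.v b' ≠ 0 := (Valuation.ne_zero_iff _).2 hb0
    rw [← exp_log hvb0, ← exp_add, exp_le_exp] at hb'le
    rw [← exp_log hvb0, exp_le_exp]; omega
  rw [hΘx, map_mul, Valuation.map_sub_swap]
  exact mul_le_mul' hb'le' le_rfl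

/-! ## §3 The `Θ`-fixed units of `𝒪_Eˣ·U^{(c)}` are `𝒪_Fˣ·U_{K♮}^{(⌈c∕2⌉)}` -/

/-- **PARITY UPGRADE**: a `Θ`-fixed `w` with `|w − 1| ≤ |ϖ|^c` has `|w − 1| ≤ |ϖ|^{2⌈c∕2⌉}` (`w − 1` is `Θ`-fixed, so its valuation is even). [cite: Serre1979, Ch. V §1] -/
theorem v_sub_one_le_of_theta_fixed (hfix : ∀ c : K, Θ c = c → c ≠ 0 → Even (log (Valued.v c))) {c : ℕ} {w : K} (hw : Θ w = w)
    (hwc : Valued.v (w - 1) ≤ exp (-(c : ℤ))) : Valued.v (w - 1) ≤ exp (-(2 * (((c : ℤ) + 1) / 2))) := by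
  rcases eq_or_ne (w - 1) 0 with h0 | h0
  · rw [h0, map_zero]; exact zero_le
  have hΘ : Θ (w - 1) = w - 1 := by rw [map_sub, map_one, hw]
  obtain ⟨k, hk⟩ := hfix _ hΘ h0
  have hv0 : Valued.v (w - 1) ≠ 0 := (Valuation.ne_zero_iff _).2 h0
  rw [← exp_log hv0, exp_le_exp] at hwc ⊢
  omega

/-- **`Θ`-FIXED UNITS OF `𝒪_Eˣ·U^{(c)}`, direction `→`** (the `Θ`-trick): if `u = e·m` is `Θ`-fixed with `e` a `ρ`-fixed unit and `|m − 1| ≤ |ϖ|^c`, then `u = f·w` with `f` a unit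
fixed by BOTH `ρ` and `Θ` and `w` a `Θ`-fixed element with `|w − 1| ≤ |ϖ|^c`.  Proof: `e = a + bϖ` in `Θ`-fixed coordinates (which are `ρ`-fixed, §2); `e·m = Θe·Θm` gives
`|b|·|ϖ − Θϖ| = |e − Θe| = |Θm − m| ≤ |ϖ|^{c−1}|ϖ − Θϖ|`, so `|b| ≤ |ϖ|^{c−1}`, `a` is a unit, and `f := a`, `w := u∕a` work (`|w − 1| = |a(m−1) + bϖm| ≤ |ϖ|^c`).
`d`-FREE: only `Θϖ ≠ ϖ` is used. [cite: Serre1979, Ch. IV §1] [cite: Serre1979, Ch. III §6 Prop. 12] -/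
theorem exists_fixed_fixed_mul_of_eq_fixed_mul (hΘΘ : ∀ x, Θ (Θ x) = x) (hΘρ : ∀ x, Θ (ρ x) = ρ (Θ x)) (hvΘ : ∀ x, Valued.v (Θ x) = Valued.v x)
    (hfix : ∀ c : K, Θ c = c → c ≠ 0 → Even (log (Valued.v c)))
    {ϖ : K} (hρϖ : ρ ϖ = ϖ) (hϖ : Valued.v ϖ = exp (-1 : ℤ)) (hΘϖ : Θ ϖ ≠ ϖ) {c : ℕ}
    {u e m : K} (hu : Θ u = u) (he : ρ e = e) (he1 : Valued.v e = 1) (hm : Valued.v (m - 1) ≤ exp (-(c : ℤ))) (hum : u = e * m) :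
    ∃ f w : K, ρ f = f ∧ Θ f = f ∧ Valued.v f = 1 ∧ Θ w = w ∧ Valued.v (w - 1) ≤ exp (-(c : ℤ)) ∧ u = f * w := by
  rcases Nat.eq_zero_or_pos c with rfl | hc
  · -- c = 0: `u = 1 · u`, and `|u − 1| ≤ 1` because `|u| = |m| ≤ 1`
    have hm0 : Valued.v m ≤ 1 := by
      have : m = (m - 1) + 1 := by ring
      rw [this]; refine (Valuation.map_add _ _ _).trans (max_le hm ?_); rw [map_one]
    refine ⟨1, u, map_one ρ, map_one Θ, map_one _, hu, ?_, (one_mul u).symm⟩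
    refine (Valuation.map_sub _ _ _).trans (max_le ?_ (by rw [map_one, Nat.cast_zero, neg_zero, exp_zero]))
    rw [hum, map_mul, he1, one_mul, Nat.cast_zero, neg_zero, exp_zero]; exact hm0
  -- `m` is a unit
  have hm1 : Valued.v m = 1 := by
    have h : Valued.v (m - 1) < Valued.v (1 : K) := by
      rw [map_one]; exact lt_of_le_of_lt hm (by rw [← exp_zero, exp_lt_exp]; omega)
    have := Valuation.map_add_eq_of_lt_left _ h
    rwa [add_sub_cancel, map_one] at this
  -- Θ-fixed coordinates of `e`
  obtain ⟨a, b, ha, hb, heab⟩ := exists_fixed_coords_of_map_ne hΘΘ hΘϖ e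
  obtain ⟨hρa, hρb⟩ := map_fixed_coords_of_commute hΘρ hρϖ hΘϖ ha hb heab he
  -- the Θ-trick: (e − Θe)·m = Θe·(Θm − m)
  have hΘe : Θ e = a + b * Θ ϖ := by rw [heab, map_add, map_mul, ha, hb]
  have hkey : (e - Θ e) * m = Θ e * (Θ m - m) := by
    have h := congrArg Θ hum
    rw [hu, map_mul] at h
    linear_combination h - hum
  have heΘe : e - Θ e = b * (ϖ - Θ ϖ) := by rw [hΘe, heab]; ring
  -- valuation consequences: |b| ≤ |ϖ|^{c−1}
  have hd0 : Valued.v (ϖ - Θ ϖ) ≠ 0 := (Valuation.ne_zero_iff _).2 (sub_ne_zero.2 (Ne.symm hΘϖ))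
  have hb_le : Valued.v b ≤ exp (-((c : ℤ) - 1)) := by
    have hshift := v_map_sub_self_le_of_v_sub_one_le hΘΘ hfix hϖ hΘϖ hm
    have h1 : Valued.v ((e - Θ e) * m) = Valued.v (Θ e * (Θ m - m)) := by rw [hkey]
    rw [map_mul, map_mul, hm1, mul_one, hvΘ, he1, one_mul, heΘe, map_mul] at h1
    have h2 : Valued.v b * Valued.v (ϖ - Θ ϖ) ≤ exp (-((c : ℤ) - 1)) * Valued.v (ϖ - Θ ϖ) := by rw [h1]; exact hshift
    exact le_of_mul_le_mul_right h2 (zero_lt_iff.2 hd0)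
  -- `a` is a unit
  have hbϖ : Valued.v b * exp (-1 : ℤ) < 1 := by
    rcases eq_or_ne b 0 with rfl | hb0
    · rw [map_zero, zero_mul]; exact zero_lt_one
    have hvb0 : Valued.v b ≠ 0 := (Valuation.ne_zero_iff _).2 hb0
    obtain ⟨k, hk⟩ := hfix b hb hb0
    have hk' : log (Valued.v b) ≤ -((c : ℤ) - 1) := by rw [← exp_log hvb0, exp_le_exp] at hb_le; exact hb_le
    rw [← exp_log hvb0, ← exp_add, ← exp_zero, exp_lt_exp]; omega
  have ha1 : Valued.v a = 1 := by
    have := he1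
    rw [heab, v_fixed_add_fixed_mul_eq_max hfix hϖ ha hb] at this
    rcases le_total (Valued.v a) (Valued.v b * exp (-1 : ℤ)) with h | h
    · rw [max_eq_right h] at this; exact absurd this (ne_of_lt hbϖ)
    · rw [max_eq_left h] at this; exact this
  have ha0 : a ≠ 0 := (Valuation.ne_zero_iff _).1 (by rw [ha1]; exact one_ne_zero)
  refine ⟨a, u / a, hρa, ha, ha1, by rw [map_div₀, hu, ha], ?_, by field_simp⟩
  -- |u/a − 1| = |u − a| = |a(m − 1) + bϖ·m| ≤ |ϖ|^c
  have hua : u / a - 1 = (u - a) / a := by field_simp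
  rw [hua, map_div₀, ha1, div_one, show u - a = a * (m - 1) + b * ϖ * m by rw [hum, heab]; ring]
  refine (Valuation.map_add _ _ _).trans (max_le ?_ ?_)
  · rw [map_mul, ha1, one_mul]; exact hm
  · rw [map_mul, map_mul, hm1, mul_one, hϖ]
    calc Valued.v b * exp (-1 : ℤ) ≤ exp (-((c : ℤ) - 1)) * exp (-1 : ℤ) := mul_le_mul' hb_le le_rfl
      _ = exp (-(c : ℤ)) := by rw [← exp_add]; ring_nf

/-- **`Θ`-FIXED UNITS OF `𝒪_Eˣ·U^{(c)}` — THE EQUIVALENCE**: for a `Θ`-fixed `u`,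
`(∃ e m, ρe = e ∧ |e| = 1 ∧ |m − 1| ≤ |ϖ|^c ∧ u = e·m) ↔ (∃ f w, ρf = f ∧ Θf = f ∧ |f| = 1 ∧ Θw = w ∧ |w − 1| ≤ |ϖ|^{2⌈c∕2⌉} ∧ u = f·w)` — in the census (type RamK):
`𝒪_{K♮}ˣ ∩ 𝒪_Eˣ·U_M^{(c)} = 𝒪_Fˣ·U_{K♮}^{(⌈c∕2⌉)}`. [cite: Serre1979, Ch. IV §1] [cite: Serre1979, Ch. V §1] -/
theorem exists_fixed_mul_iff_exists_fixed_fixed_mul (hΘΘ : ∀ x, Θ (Θ x) = x) (hΘρ : ∀ x, Θ (ρ x) = ρ (Θ x)) (hvΘ : ∀ x, Valued.v (Θ x) = Valued.v x)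
    (hfix : ∀ c : K, Θ c = c → c ≠ 0 → Even (log (Valued.v c)))
    {ϖ : K} (hρϖ : ρ ϖ = ϖ) (hϖ : Valued.v ϖ = exp (-1 : ℤ)) (hΘϖ : Θ ϖ ≠ ϖ) (c : ℕ) {u : K} (hu : Θ u = u) :
    (∃ e m : K, ρ e = e ∧ Valued.v e = 1 ∧ Valued.v (m - 1) ≤ exp (-(c : ℤ)) ∧ u = e * m) ↔
      ∃ f w : K, ρ f = f ∧ Θ f = f ∧ Valued.v f = 1 ∧ Θ w = w ∧ Valued.v (w - 1) ≤ exp (-(2 * (((c : ℤ) + 1) / 2))) ∧ u = f * w := by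
  constructor
  · rintro ⟨e, m, he, he1, hm, hum⟩
    obtain ⟨f, w, hf, hΘf, hf1, hΘw, hw, huw⟩ := exists_fixed_fixed_mul_of_eq_fixed_mul hΘΘ hΘρ hvΘ hfix hρϖ hϖ hΘϖ hu he he1 hm hum
    exact ⟨f, w, hf, hΘf, hf1, hΘw, v_sub_one_le_of_theta_fixed hfix hΘw hw, huw⟩
  · rintro ⟨f, w, hf, -, hf1, -, hw, huw⟩
    refine ⟨f, w, hf, hf1, hw.trans ?_, huw⟩
    rw [exp_le_exp]; omega

/-- **THE SAME, READ ON THE ORDER PREDICATE** (what the T5 sheets consume: `IsOrd ρ α (ϖ^c) u` for a `Θ`-fixed UNIT `u`): `u` lies in the order of conductor `ϖ^c` iff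
`u ∈ 𝒪_Fˣ·U_{K♮}^{(⌈c∕2⌉)}`, i.e. `u = f·w` with `f` a `ρ`- and `Θ`-fixed unit and `w` `Θ`-fixed with `|w − 1| ≤ |ϖ|^{2⌈c∕2⌉}`. [cite: Serre1979, Ch. III §6 Prop. 12] [cite: Serre1979, Ch. IV §1] -/
theorem mem_order_iff_exists_fixed_fixed_mul_of_theta_fixed (hρρ : ∀ x, ρ (ρ x) = x) (hvρ : ∀ x, Valued.v (ρ x) = Valued.v x) (hα : ρ α ≠ α) (hα1 : Valued.v α ≤ 1)
    (hint : ∀ z : K, Valued.v z ≤ 1 → Valued.v ((z - ρ z) / (α - ρ α)) ≤ 1)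
    (hΘΘ : ∀ x, Θ (Θ x) = x) (hΘρ : ∀ x, Θ (ρ x) = ρ (Θ x)) (hvΘ : ∀ x, Valued.v (Θ x) = Valued.v x) (hfix : ∀ c : K, Θ c = c → c ≠ 0 → Even (log (Valued.v c)))
    {ϖ : K} (hρϖ : ρ ϖ = ϖ) (hϖ : Valued.v ϖ = exp (-1 : ℤ)) (hΘϖ : Θ ϖ ≠ ϖ) (c : ℕ) {u : K} (hu : Θ u = u) (hu1 : Valued.v u = 1) :
    (Valued.v u ≤ 1 ∧ Valued.v (u - ρ u) ≤ Valued.v (ϖ ^ c * (α - ρ α))) ↔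
      ∃ f w : K, ρ f = f ∧ Θ f = f ∧ Valued.v f = 1 ∧ Θ w = w ∧ Valued.v (w - 1) ≤ exp (-(2 * (((c : ℤ) + 1) / 2))) ∧ u = f * w := by
  rw [exists_fixed_mul_near_one_iff_mem_order hρρ hvρ hα hα1 hint hρϖ hϖ c hu1]
  exact exists_fixed_mul_iff_exists_fixed_fixed_mul hΘΘ hΘρ hvΘ hfix hρϖ hϖ hΘϖ c hu

end Literature.NumberTheory.LocalFields.QuadraticOrder
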